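import Literature.NumberTheory.DiophantineGeometry.AVIsogenyTateHomProofs
import Literature.NumberTheory.DiophantineGeometry.AVIsogenyTateInjectiveProofs
import Literature.NumberTheory.DiophantineGeometry.AVIsogenyTateFinrankHomProofs
import HarnessLib

/-!
# `Hom(A, B)` finitely generated (Mumford §19, Theorem 3): Step II and the reduction to Step I

Sequel of `Literature/NumberTheory/DiophantineGeometry/AVIsogenyTateHomProofs.lean` (Step III and
the formal lemmas) for the named fact
`Literature.AlgebraicGeometry.Motives.AbelianVariety.module_finite_hom A B` of `AVIsogenyTate`
(`Hom(A, B)` is finitely generated; Mumford, *Abelian Varieties*, §19, Theorem 3; Milne 1986,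
Theorem 12.5).

* `AbelianVariety.faltingsTateMap_comp_baseChange_injective_of_saturated` — **Step II** of the
  printed proof: for a prime `ℓ` invertible in `K` and a *saturated* finitely generated
  `M ≤ Hom(A, B)`, the Tate map is injective on `ℤ_ℓ ⊗ M` (Milne 1986, Lemma 12.6 —
  `exists_eq_pow_smul_of_tateModuleMap_eq` of `AVIsogenyTateInjectiveProofs` — feeds the `ℓ`-adic
  criterion `PadicInt.injective_of_forall_exists_eq_pow_smul` of the same file; saturation replaces
  Milne's condition `(*)`), whence `rank M ≤ rank_{ℤ_ℓ} Hom_{Γ_K}(T_ℓ A, T_ℓ B)`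
  (`rank_le_rank_tateHom_of_saturated`);
* `AbelianVariety.rank_hom_le_of_exists_fg_of_tateModule_linearEquiv` — granted Step I
  (saturations of finitely generated subgroups lie in finitely generated subgroups) and
  `T_ℓ ≅ ℤ_ℓ^{2 dim}`, `rank_ℤ Hom(A, B) ≤ 4 dim A dim B`;
* `AbelianVariety.module_finite_hom_of_exists_fg_of_tateModule_linearEquiv` and
  `AbelianVariety.module_finite_hom_of_exists_fg_of_natCard_torsionPoints` — the named fact
  `module_finite_hom A B` from Step I and the structure of the Tate modules, resp. from Step I and
  the torsion counts `natCard_torsionPoints_of_isAlgClosed` of `A`, `B` over `K̄` (Mumford §6,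
  Proposition p. 64; in the tree downstream of the theorem of the cube).

So Theorem 3 of Mumford §19 — and with it `module_free_hom`, `finrank_hom_le`,
`faltingsTateMap_injective`, `finiteDimensional_endAlgebra`, reduced to it in the sibling proof
files — rests in the tree on exactly two inputs: **Step I** (Poincaré's complete reducibility
theorem, Mumford §19 Thm. 1; non-zero homomorphisms between simple abelian varieties are
isogenies; the degree is a homogeneous polynomial function of degree `2 dim`, §19 Thm. 2 — none of
which the tree has; the discreteness argument that turns them into Step I is `fg_of_norm` of
`AVIsogenyTateHomProofs`) and the **theorem of the cube** (for the torsion counts).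

## References

* [MumfordAV1970] D. Mumford, *Abelian Varieties*, §19, Theorem 3 and its proof (pp. 176–178 of
  the 2nd ed.), Corollary 1. Not held; architecture as in Milne 1986.
* [Milne1986AbelianVarieties] J. S. Milne, *Abelian Varieties*, in Cornell–Silverman (eds.),
  *Arithmetic Geometry*, Springer 1986, §12, Thm. 12.5 and Lemmas 12.6–12.7 (held:
  `book:cornellnd-arithmetic-geometry`, PDF pp. 190–192).

## Design

No definitions, no named facts. Saturation of `M ≤ Hom(A, B)` is the hypothesis
`∀ n f, n ≠ 0 → n • f ∈ M → f ∈ M`; "the saturation of `M` lies in a finitely generated subgroup"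
is spelled as in `AVIsogenyTateHomProofs`. The saturation of `ℤs` needed in the rank bound is
built inside the proof as an anonymous `Submodule`.
-/

universe u

open CategoryTheory

noncomputable section

namespace Literature.NumberTheory.DiophantineGeometry

section AbelianVariety
open Literature.AlgebraicGeometry.Motives (AbelianVariety)
open Literature.AlgebraicGeometry.Motives.AbelianVariety

variable {K : Type u} [Field K] {A B : AbelianVariety K}

open scoped TensorProduct

variable (ℓ : ℕ) [Fact ℓ.Prime]

/-- **Step II of Mumford's proof of §19 Thm. 3 (Milne 1986, Lemma 12.7 without the simplicity
hypothesis, for a saturated `M`).** Let `ℓ` be a prime invertible in `K` and `M ≤ Hom(A, B)` a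
finitely generated subgroup which is *saturated* (`n f ∈ M`, `n ≠ 0` ⇒ `f ∈ M`, i.e. `M = ℚM ∩
Hom(A, B)`). Then the Tate map is injective on `ℤ_ℓ ⊗ M`: a relation `∑ aᵢ T_ℓ(eᵢ) = 0` would, after
`ℓ`-adic approximation of the `aᵢ` by integers, produce `f ∈ M` with `T_ℓ f ≡ 0 (mod ℓⁿ)`, hence
`f = ℓⁿ g` in `Hom(A, B)` (Milne Lemma 12.6, `exists_eq_pow_smul_of_tateModuleMap_eq`) with `g ∈ M`
by saturation — which is the divisibility hypothesis of the `ℓ`-adic criterion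
`PadicInt.injective_of_forall_exists_eq_pow_smul`. (Mumford, *Abelian Varieties*, §19, proof of
Thm. 3, second step; Milne 1986, proof of Lemma 12.7 and of Thm. 12.5.)
[cite: MumfordAV1970, §19 Thm. 3 (proof, second step)] -/
theorem _root_.Literature.AlgebraicGeometry.Motives.AbelianVariety.faltingsTateMap_comp_baseChange_injective_of_saturated
    (hℓ : (ℓ : K) ≠ 0) (M : Submodule ℤ (A ⟶ B)) (hM : M.FG)
    (hsat : ∀ (n : ℤ) (f : A ⟶ B), n ≠ 0 → n • f ∈ M → f ∈ M) :
    Function.Injective ((faltingsTateMap A B ℓ).comp (M.subtype.baseChange ℤ_[ℓ])) := by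
  haveI : Module.Finite ℤ M := Module.Finite.iff_fg.2 hM
  refine PadicInt.injective_of_forall_exists_eq_pow_smul _ fun n ψ g h => ?_
  have h1 : homToTate A B ℓ (ψ : A ⟶ B) = ((ℓ : ℤ_[ℓ]) ^ n) • g := by
    rw [← faltingsTateMap_one_tmul]
    simpa only [LinearMap.comp_apply, LinearMap.baseChange_tmul, Submodule.subtype_apply] using h
  have h2 : tateModuleMap ℓ (ψ : A ⟶ B) = ((ℓ : ℤ_[ℓ]) ^ n) • g.toLinearMap := by
    rw [← toLinearMap_tateIntertwiningMap, ← homToTate_apply, h1,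
      Representation.IntertwiningMap.toLinearMap_smul]
  obtain ⟨χ, hχ⟩ := exists_eq_pow_smul_of_tateModuleMap_eq ℓ hℓ n (ψ : A ⟶ B) g.toLinearMap h2
  have hℓ0 : ((ℓ : ℤ) ^ n) ≠ 0 :=
    pow_ne_zero _ (Int.natCast_ne_zero.2 (Fact.out : ℓ.Prime).ne_zero)
  have hχM : χ ∈ M := hsat _ χ hℓ0 (by rw [← hχ]; exact ψ.2)
  exact ⟨⟨χ, hχM⟩, Subtype.ext hχ⟩

/-- **`rank M ≤ rank_{ℤ_ℓ} Hom_{Γ_K}(T_ℓ A, T_ℓ B)` for a saturated finitely generated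
`M ≤ Hom(A, B)`** and a prime `ℓ` invertible in `K` (Mumford §19, proof of Thm. 3: "hence
`rank M ≤ 4 dim X dim Y`"): `rank_ℤ M = rank_{ℤ_ℓ} (ℤ_ℓ ⊗ M)` (Mathlib `IsBaseChange.rank_eq`) and
`ℤ_ℓ ⊗ M → Hom_{Γ_K}(T_ℓ A, T_ℓ B)` is injective
(`faltingsTateMap_comp_baseChange_injective_of_saturated`). [cite: MumfordAV1970, §19 Thm. 3 (proof, second step)] -/
theorem _root_.Literature.AlgebraicGeometry.Motives.AbelianVariety.rank_le_rank_tateHom_of_saturated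
    (hℓ : (ℓ : K) ≠ 0) (M : Submodule ℤ (A ⟶ B)) (hM : M.FG)
    (hsat : ∀ (n : ℤ) (f : A ⟶ B), n ≠ 0 → n • f ∈ M → f ∈ M) :
    Module.rank ℤ M ≤ Module.rank ℤ_[ℓ] (tateHom A B ℓ) :=
  (TensorProduct.isBaseChange ℤ M ℤ_[ℓ]).rank_eq.symm.trans_le
    (LinearMap.rank_le_of_injective _
      (faltingsTateMap_comp_baseChange_injective_of_saturated ℓ hℓ M hM hsat))

/-- **The rank bound of Mumford §19 Thm. 3 from Step I.** If the saturation
`{f | n f ∈ M, some n ≠ 0}` of every finitely generated `M ≤ Hom(A, B)` lies in a finitely generated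
subgroup (Step I of the printed proof), and `T_ℓ A ≅ ℤ_ℓ^{2 dim A}`, `T_ℓ B ≅ ℤ_ℓ^{2 dim B}` at a
prime `ℓ` invertible in `K` (Mumford §19, p. 171), then `rank_ℤ Hom(A, B) ≤ 4 dim A dim B`: every
finite linearly independent `s ⊆ Hom(A, B)` lies in the saturation `S` of `ℤs`, which is finitely
generated and saturated, so `#s ≤ rank S ≤ rank Hom_{Γ_K}(T_ℓ A, T_ℓ B) ≤ rank Hom_{ℤ_ℓ}(T_ℓ A, T_ℓ B)
= 4 dim A dim B` (`rank_le_rank_tateHom_of_saturated` and the bookkeeping of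
`AVIsogenyTateFinrankHomProofs`). [cite: MumfordAV1970, §19 Thm. 3 (proof) and Cor. 1] -/
theorem _root_.Literature.AlgebraicGeometry.Motives.AbelianVariety.rank_hom_le_of_exists_fg_of_tateModule_linearEquiv
    (hsat : ∀ M : Submodule ℤ (A ⟶ B), M.FG →
      ∃ S : Submodule ℤ (A ⟶ B), S.FG ∧ ∀ f : A ⟶ B, (∃ n : ℤ, n ≠ 0 ∧ n • f ∈ M) → f ∈ S)
    (hℓ : (ℓ : K) ≠ 0) (eA : A.tateModule ℓ ≃ₗ[ℤ_[ℓ]] (Fin (2 * A.dim) → ℤ_[ℓ]))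
    (eB : B.tateModule ℓ ≃ₗ[ℤ_[ℓ]] (Fin (2 * B.dim) → ℤ_[ℓ])) :
    Module.rank ℤ (A ⟶ B) ≤ (4 * A.dim * B.dim : ℕ) := by
  haveI : Module.Free ℤ_[ℓ] (A.tateModule ℓ) := Module.Free.of_equiv eA.symm
  haveI : Module.Finite ℤ_[ℓ] (A.tateModule ℓ) := Module.Finite.equiv eA.symm
  haveI : Module.Free ℤ_[ℓ] (B.tateModule ℓ) := Module.Free.of_equiv eB.symm
  haveI : Module.Finite ℤ_[ℓ] (B.tateModule ℓ) := Module.Finite.equiv eB.symm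
  have h4 : Module.finrank ℤ_[ℓ] (A.tateModule ℓ) * Module.finrank ℤ_[ℓ] (B.tateModule ℓ) =
      4 * A.dim * B.dim := by
    rw [eA.finrank_eq, eB.finrank_eq, Module.finrank_fin_fun, Module.finrank_fin_fun]; ring
  -- the bound for saturated finitely generated subgroups
  have hbound : ∀ S : Submodule ℤ (A ⟶ B), S.FG →
      (∀ (n : ℤ) (f : A ⟶ B), n ≠ 0 → n • f ∈ S → f ∈ S) →
      Module.rank ℤ S ≤ (4 * A.dim * B.dim : ℕ) := fun S hS hSsat =>
    calc Module.rank ℤ S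
        ≤ Module.rank ℤ_[ℓ] (tateHom A B ℓ) := rank_le_rank_tateHom_of_saturated ℓ hℓ S hS hSsat
      _ ≤ Module.rank ℤ_[ℓ] (A.tateModule ℓ →ₗ[ℤ_[ℓ]] B.tateModule ℓ) := rank_tateHom_le A B ℓ
      _ = (Module.finrank ℤ_[ℓ] (A.tateModule ℓ) * Module.finrank ℤ_[ℓ] (B.tateModule ℓ) : ℕ) :=
          rank_linearMap_tateModule A B ℓ
      _ = (4 * A.dim * B.dim : ℕ) := by rw [h4]
  apply rank_le
  intro s hs
  -- `M = ℤs` and its saturation `S'`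
  set M : Submodule ℤ (A ⟶ B) := Submodule.span ℤ (s : Set (A ⟶ B)) with hM_def
  let S' : Submodule ℤ (A ⟶ B) :=
    { carrier := {f | ∃ n : ℤ, n ≠ 0 ∧ n • f ∈ M}
      add_mem' := by
        rintro f g ⟨n, hn, hf⟩ ⟨m, hm, hg⟩
        refine ⟨m * n, mul_ne_zero hm hn, ?_⟩
        rw [smul_add]
        refine M.add_mem ?_ ?_
        · rw [mul_smul]; exact M.smul_mem m hf
        · rw [mul_comm, mul_smul]; exact M.smul_mem n hg
      zero_mem' := ⟨1, one_ne_zero, by rw [smul_zero]; exact M.zero_mem⟩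
      smul_mem' := by
        rintro c f ⟨n, hn, hf⟩
        exact ⟨n, hn, by rw [smul_comm]; exact M.smul_mem c hf⟩ }
  have hS'mem : ∀ f : A ⟶ B, f ∈ S' ↔ ∃ n : ℤ, n ≠ 0 ∧ n • f ∈ M := fun f => Iff.rfl
  have hS'sat : ∀ (k : ℤ) (f : A ⟶ B), k ≠ 0 → k • f ∈ S' → f ∈ S' := by
    rintro k f hk ⟨n, hn, hf⟩
    exact ⟨n * k, mul_ne_zero hn hk, by rwa [mul_smul]⟩
  -- `S'` is finitely generated: it lies in the finitely generated `S` given by Step I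
  obtain ⟨S, hSfg, hS⟩ := hsat M (Submodule.fg_span s.finite_toSet)
  have hle : S' ≤ S := fun f hf => hS f ((hS'mem f).1 hf)
  have hS'fg : S'.FG := by
    haveI : Module.Finite ℤ S := Module.Finite.iff_fg.2 hSfg
    have h := (IsNoetherian.noetherian (R := ℤ) (M := S) (S'.comap S.subtype)).map S.subtype
    rwa [Submodule.map_comap_subtype, inf_eq_right.2 hle] at h
  -- `s ⊆ S'` is linearly independent in `S'`
  have hsub : ∀ f : A ⟶ B, f ∈ s → f ∈ S' := fun f hf =>
    ⟨1, one_ne_zero, by rw [one_smul]; exact Submodule.subset_span hf⟩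
  have hs' : LinearIndependent ℤ fun i : s => (⟨(i : A ⟶ B), hsub i i.2⟩ : S') :=
    LinearIndependent.of_comp S'.subtype hs
  have hcard := hs'.cardinal_le_rank.trans (hbound S' hS'fg hS'sat)
  rw [Cardinal.mk_coe_finset] at hcard
  exact_mod_cast hcard

variable (A B) in
/-- **Mumford §19 Thm. 3 (finite generation of `Hom(A, B)`) reduced to Step I and the structure
of the Tate modules.** If the saturation of every finitely generated subgroup of `Hom(A, B)` lies in
a finitely generated subgroup (Step I of the printed proof: Poincaré reducibility, simplicity and
the degree polynomial) and `T_ℓ A ≅ ℤ_ℓ^{2 dim A}`, `T_ℓ B ≅ ℤ_ℓ^{2 dim B}` at a prime `ℓ`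
invertible in `K`, then `Hom(A, B)` is finitely generated — Step II gives the rank bound
(`rank_hom_le_of_exists_fg_of_tateModule_linearEquiv`) and Step III
(`module_finite_int_of_rank_le_of_exists_fg`) concludes. [cite: MumfordAV1970, §19 Thm. 3 (proof)] -/
theorem _root_.Literature.AlgebraicGeometry.Motives.AbelianVariety.module_finite_hom_of_exists_fg_of_tateModule_linearEquiv
    (hsat : ∀ M : Submodule ℤ (A ⟶ B), M.FG →
      ∃ S : Submodule ℤ (A ⟶ B), S.FG ∧ ∀ f : A ⟶ B, (∃ n : ℤ, n ≠ 0 ∧ n • f ∈ M) → f ∈ S)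
    (hℓ : (ℓ : K) ≠ 0) (eA : A.tateModule ℓ ≃ₗ[ℤ_[ℓ]] (Fin (2 * A.dim) → ℤ_[ℓ]))
    (eB : B.tateModule ℓ ≃ₗ[ℤ_[ℓ]] (Fin (2 * B.dim) → ℤ_[ℓ])) :
    module_finite_hom A B :=
  module_finite_int_of_rank_le_of_exists_fg _
    (rank_hom_le_of_exists_fg_of_tateModule_linearEquiv ℓ hsat hℓ eA eB) hsat

omit [Fact ℓ.Prime] in
variable (A B) in
/-- **Mumford §19 Thm. 3 reduced to Step I and the torsion counts.** The named fact
`module_finite_hom A B` follows from Step I of the printed proof (saturations of finitely generated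
subgroups of `Hom(A, B)` lie in finitely generated subgroups) together with the named facts
`natCard_torsionPoints_of_isAlgClosed` for `A` and `B` over `K̄` (`#A[n](K̄) = n^{2 dim A}` for `n`
invertible in `K`, Mumford §6, Proposition p. 64 — in the tree downstream of the theorem of the
cube), which give `T_ℓ ≅ ℤ_ℓ^{2 dim}` at a prime `ℓ ≠ char K`
(`nonempty_tateModule_linearEquiv_of_natCard_torsionPoints`, `exists_prime_natCast_ne_zero`). So in
the tree Theorem 3 of Mumford §19, and with it the whole cluster `module_free_hom`,
`finrank_hom_le`, `faltingsTateMap_injective`, `finiteDimensional_endAlgebra` (sibling proof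
files), rests on Step I and the theorem of the cube. [cite: MumfordAV1970, §19 Thm. 3 (proof)] -/
theorem _root_.Literature.AlgebraicGeometry.Motives.AbelianVariety.module_finite_hom_of_exists_fg_of_natCard_torsionPoints
    (hsat : ∀ M : Submodule ℤ (A ⟶ B), M.FG →
      ∃ S : Submodule ℤ (A ⟶ B), S.FG ∧ ∀ f : A ⟶ B, (∃ n : ℤ, n ≠ 0 ∧ n • f ∈ M) → f ∈ S)
    (hA : A.natCard_torsionPoints_of_isAlgClosed (AlgebraicClosure K))
    (hB : B.natCard_torsionPoints_of_isAlgClosed (AlgebraicClosure K)) :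
    module_finite_hom A B := by
  obtain ⟨ℓ, hℓp, hℓ⟩ := exists_prime_natCast_ne_zero K
  haveI : Fact ℓ.Prime := ⟨hℓp⟩
  obtain ⟨eA⟩ := A.nonempty_tateModule_linearEquiv_of_natCard_torsionPoints ℓ hA hℓ
  obtain ⟨eB⟩ := B.nonempty_tateModule_linearEquiv_of_natCard_torsionPoints ℓ hB hℓ
  exact module_finite_hom_of_exists_fg_of_tateModule_linearEquiv A B ℓ hsat hℓ eA eB


end AbelianVariety

end Literature.NumberTheory.DiophantineGeometry
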